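import Literature.NumberTheory.Transcendental.TwistedTorus
import Literature.NumberTheory.Transcendental.KaehlerHodge
import Literature.NumberTheory.Transcendental.ComplexFormsProofs
import Literature.Geometry.Kaehler.HodgeStarProofs
import Mathlib.Analysis.SpecialFunctions.Complex.Log
import Mathlib.Analysis.SpecialFunctions.ExpDeriv
import Mathlib.LinearAlgebra.Dimension.Finite
import HarnessLib

/-!
# The named fact `finite_dolbeaultHarmonicForms` is false as stated (the twisted torus)

`Literature/NumberTheory/Transcendental/KaehlerHodge.lean` records the finite-dimensionality of
the spaces `ℋ^{p,q}` of `∂̄`-harmonic forms on a compact Hermitian manifold (Voisin (2002),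
Cor. 5.20: `Δ_∂̄` is elliptic; Thm. 5.22: kernels of elliptic operators on compact manifolds are
finite-dimensional; Thm. 5.24 / Cor. 5.25) as the named fact
`Literature.NumberTheory.Transcendental.finite_dolbeaultHarmonicForms g o`. That
`def … : Prop` is an M5 mechanical rewrite of a sorried theorem and abstracts only the section
variables its body uses: the **holomorphic atlas** `[IsManifold 𝓘(ℂ, E) ω M]` of its section is
*not* among its binders (only `[IsManifold 𝓘(ℝ, E) ∞ M]`, through the type of the metric `g`).
As elaborated it therefore quantifies over arbitrary compact `C^∞` real manifolds charted on
`E`, on which the "complex structure" `J_x = i •` of `TangentSpace 𝓘(ℝ, E) x = E` is read in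
the preferred chart `chartAt x`. In that generality the fact is **false**. The primary refutation,
with the universal closures over exactly the binders of the fact, is `KaehlerHodgeFiniteCounterexample.lean`
(`TorusConjAtlas.not_finite_dolbeaultHarmonicForms_torus`, `not_forall_finite_dolbeaultHarmonicForms`,
`not_finite_dolbeaultHarmonicForms`: `ℋ^{1,1}` of the `{id, conj}`-rigged torus `(ℝ/ℤ)²` is
infinite-dimensional). This file is the **degree-`0` companion** on the twisted torus `ℂ/ℤ[i]` of
`TwistedTorus.lean` (the refutation that file was built for): there even the space `ℋ^{0,0}` of
`∂̄`-harmonic *functions* is infinite-dimensional — every character `e^{2πi n Re z}` is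
`Δ_∂̄`-harmonic (`TwistedTorus.not_finite_dolbeaultHarmonicForms_twistedTorus`), whereas on an
honest complex torus `ℋ^{0,0} = ℂ`. The corrected statement, binding the holomorphic atlas, is
`Literature.NumberTheory.Transcendental.finite_dolbeaultHarmonicForms_of_isManifold`
(`KaehlerHodgeComplexAtlasFact.lean`); it is Voisin's theorem and stays a named fact (elliptic
theory; reduced to Warner's compactness theorem 6.6 in `KaehlerHodgeEllipticReductionProofs.lean`).

## The counterexample (`namespace TwistedTorus`, manifold and metric from `TwistedTorus.lean`)

* `M = ℂ/ℤ[i]` with the *twisted* smooth atlas of `TwistedTorus.lean`: local inverses of the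
  covering projection on the dense set `D = {Re ∈ ℚ}` and their complex conjugates off `D`
  (`E = ℂ`, `n = 2`); tangent coordinate changes are `id` or `conj`. The flat metric
  `TwistedTorus.flatMetric` (standard inner product on every tangent space) is a smooth Hermitian
  metric, the orientation family `TwistedTorus.orient` (`±` the standard orientation according to
  `D`) has constant chart representatives of its volume form, so the hypotheses `hg`, `ho` of the
  fact hold; `M` is compact Hausdorff. We take degree `k = 0` (`m = 2`) and type `(p,q) = (0,0)`.
* For `n ≥ 1` let `f_n` be the character `f_n (proj z) = e^{2πi n Re z}` and `F n` the complex
  `0`-form it defines (smooth, of type `(0,0)`). Honest computations in the chart at each point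
  give `dF_n = a_n dv + a_n dv̄` with `a_n = πi n f_n` (`dv = id`, `dv̄ = conj` on
  `TangentSpace = ℂ`; `TwistedTorus.mextDeriv_F_eq`), hence `∂̄F_n = a_n dv̄`
  (`TwistedTorus.dolbeaultBar_F`, the discharged type calculus of `ComplexFormsProofs.lean`), and
  the `ℂ`-linear Hodge star of the tree gives `⋆(c dv̄) = (ε i c) dv̄` with `ε = ±1` the sign of
  the orientation (`TwistedTorus.cHodgeStar_dvbar`, from the discharged two-dimensional check
  `hodgeStar_apply_eq_areaForm_holds`). So `γ_n = ⋆∂̄F_n = b_n dv̄`, `b_n = ∓π n f_n`.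
* **The junk.** Read in the chart at `x₀`, the form `b_n dv̄` evaluated on the vector `1` is
  `-π n e^{2πi n Re y}` at points with `Re y ∈ ℚ` and `+π n e^{2πi n Re y}` elsewhere
  (`TwistedTorus.inChart_dvbar_b_apply_one`: the sign of the orientation and the conjugation of
  the chart flip together on the dense set): it is continuous at *no* point
  (`TwistedTorus.not_continuousAt_inChart_dvbar_b`). Mathlib's `fderivWithin` of a
  non-differentiable map is the junk value `0`, so the tree's chart-wise exterior derivative gives
  `d(b_n dv̄) = 0` identically (`TwistedTorus.mextDeriv_dvbar_b`), whence `∂γ_n = 0`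
  (`TwistedTorus.dolbeault_dvbar_b`) and `Δ_∂̄ F_n = ∂̄*∂̄F_n = -⋆∂⋆∂̄F_n = 0`
  (`TwistedTorus.dolbeaultLaplacian_F`): **every character is `∂̄`-harmonic**
  (`TwistedTorus.isDolbeaultHarmonic_F`).
* The `F n`, `n ≥ 1`, are linearly independent over `ℂ` (Dedekind's independence of characters,
  `linearIndependent_monoidHom`, after evaluation along the real line;
  `TwistedTorus.linearIndependent_F_succ`), so `ℋ^{0,0}` is not finite-dimensional
  (`TwistedTorus.not_module_finite_dolbeaultHarmonicForms`), contradicting the fact at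
  `(E, M, g, o) = (ℂ, TwistedTorus, flatMetric, orient)`, `k = 0`, `m = 2`, `p = q = 0`.

On a genuine complex torus (holomorphic atlas) none of this happens: `⋆∂̄F_n = -π n f_n dz̄` is
smooth, `∂(⋆∂̄F_n) ≠ 0`, and `ℋ^{0,0} = ℂ`. The same twisted torus refutes, as elaborated, the
other facts of the sections `Hermitian`/`Kaehler` of `KaehlerHodge.lean` that lost the holomorphic
atlas (e.g. `dolbeaultHarmonicForms_le_dolbeaultClosedForms`: `F n` is harmonic but
`∂̄F_n = a_n dv̄ ≠ 0`; cf. the sibling `…Counterexample.lean` files of this directory); only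
`finite_dolbeaultHarmonicForms` is treated here.

## References

* C. Voisin, *Hodge Theory and Complex Algebraic Geometry I* (2002), §2.1 (complex manifolds:
  holomorphic transition maps), §5.2–5.3: Def. 5.17, Lemma 5.19, Cor. 5.20, Thm. 5.22,
  Thm. 5.24, Cor. 5.25 — the intended statement, `finite_dolbeaultHarmonicForms_of_isManifold`.
-/

noncomputable section

open scoped Manifold ContDiff Topology ComplexConjugate
open Set Module Function Bundle

namespace Literature.NumberTheory.Transcendental

namespace TwistedTorus

open Literature.Geometry.Kaehler _root_.ContinuousAlternatingMap Filter

attribute [local instance] Complex.finrank_real_complex_fact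

/-! ### The characters `e_n(z) = e^{2πi n Re z}` -/

/-- The character `e_n(z) = exp(2πi n Re z)` on `ℂ` (periodic for the Gaussian lattice).
[folklore] -/
def e (n : ℕ) (z : ℂ) : ℂ := Complex.exp (2 * Real.pi * Complex.I * n * (z.re : ℂ))

/-- `e_n` never vanishes. [folklore] -/
theorem e_ne_zero (n : ℕ) (z : ℂ) : e n z ≠ 0 := Complex.exp_ne_zero _

/-- `e_n` only depends on the real part. [folklore] -/
theorem e_eq_of_re_eq (n : ℕ) {z w : ℂ} (h : z.re = w.re) : e n z = e n w := by
  simp only [e, h]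

/-- `e_n` is invariant under the twists (which preserve real parts). [folklore] -/
@[simp]
theorem e_twist (n : ℕ) (x : TwistedTorus) (z : ℂ) : e n (twist x z) = e n z :=
  e_eq_of_re_eq n (re_twist x z)

/-- `e_n` is periodic for the Gaussian lattice. [folklore] -/
theorem e_add_of_mem (n : ℕ) {z c : ℂ} (hc : c ∈ gaussLattice) : e n (z + c) = e n z := by
  obtain ⟨m, hm⟩ := exists_re_eq_intCast_of_mem_gaussLattice hc
  have h1 : Complex.exp (2 * Real.pi * Complex.I * n * (m : ℂ)) = 1 := by
    rw [Complex.exp_eq_one_iff]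
    exact ⟨n * m, by push_cast; ring⟩
  unfold e
  rw [Complex.add_re, hm, Complex.ofReal_add, Complex.ofReal_intCast, mul_add, Complex.exp_add, h1,
    mul_one]

/-- The real-part functional `v ↦ Re v` of `ℂ = ℝ²`, with complex values. [folklore] -/
def reL : ℂ →L[ℝ] ℂ := Complex.ofRealCLM.comp Complex.reCLM

/-- `reL v = Re v`. [folklore] -/
@[simp]
theorem reL_apply (v : ℂ) : reL v = (v.re : ℂ) := rfl

/-- `e_n` is smooth. [folklore] -/
theorem contDiff_e (n : ℕ) : ContDiff ℝ ∞ (e n) :=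
  Complex.contDiff_exp.comp (contDiff_const.mul reL.contDiff)

/-- **The derivative of `e_n`**: `D e_n(z) = 2πi n e_n(z) · Re`. [folklore] -/
theorem hasFDerivAt_e (n : ℕ) (z : ℂ) :
    HasFDerivAt (e n) ((2 * Real.pi * Complex.I * n * e n z) • reL) z := by
  have h1 : HasFDerivAt (fun w : ℂ ↦ 2 * Real.pi * Complex.I * n * (w.re : ℂ))
      ((2 * Real.pi * Complex.I * n : ℂ) • reL) z := by
    have h := (reL.hasFDerivAt (x := z)).const_mul (2 * Real.pi * Complex.I * n : ℂ)
    simpa only [reL_apply] using h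
  have h2 := h1.cexp
  have heq : Complex.exp (2 * Real.pi * Complex.I * n * (z.re : ℂ)) •
      ((2 * Real.pi * Complex.I * n : ℂ) • reL) = (2 * Real.pi * Complex.I * n * e n z) • reL := by
    rw [smul_smul, e]
    congr 1
    ring
  rw [heq] at h2
  exact h2

/-! ### The characters on the twisted torus and the `0`-forms `F n` -/

/-- The character `f_n` on the torus, `f_n (proj z) = e_n(z)` (defined through the chosen lift).
[folklore] -/
def fT (n : ℕ) (x : TwistedTorus) : ℂ := e n (lift x)

/-- `f_n ∘ proj = e_n`. [folklore] -/
@[simp]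
theorem fT_proj (n : ℕ) (z : ℂ) : fT n (proj z) = e n z := by
  unfold fT
  have h : lift (proj z) - z ∈ gaussLattice := proj_eq_proj_iff.mp (proj_lift (proj z)).symm
  have : lift (proj z) = z + (lift (proj z) - z) := by ring
  rw [this, e_add_of_mem n h]

/-- `f_n` at a point is `e_n` at the centre of its straight chart. [folklore] -/
theorem e_sChart_self (n : ℕ) (x : TwistedTorus) : e n (sChart x x) = fT n x := by
  rw [← fT_proj, proj_sChart (mem_sChart_source x)]

/-- The complex `0`-form `F n` attached to the character `f_n`. [folklore] -/
def F (n : ℕ) : MForm 𝓘(ℝ, ℂ) TwistedTorus ℂ 0 := fun x ↦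
  constOfIsEmpty ℝ (TangentSpace 𝓘(ℝ, ℂ) x) (Fin 0) (fT n x)

/-- `F n x v = f_n x`. [folklore] -/
@[simp]
theorem F_apply (n : ℕ) (x : TwistedTorus) (v : Fin 0 → TangentSpace 𝓘(ℝ, ℂ) x) :
    F n x v = fT n x := rfl

/-- **The chart representative of `F n` in every chart is `y ↦ e_n(y)`** (the twists preserve
`Re`). [folklore] -/
theorem inChart_F (n : ℕ) (x₀ : TwistedTorus) :
    (F n).inChart x₀ = fun y ↦ constOfIsEmpty ℝ ℂ (Fin 0) (e n y) := by
  funext y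
  ext v
  rw [MForm.inChart_apply, constOfIsEmpty_apply]
  change fT n ((extChartAt 𝓘(ℝ, ℂ) x₀).symm y) = e n y
  rw [extChartAt_coe_symm, Function.comp_apply, fT_proj, e_twist]

/-- `F n` is a smooth form. [folklore] -/
theorem isSmoothForm_F (n : ℕ) : IsSmoothForm (F n) := by
  intro x₀
  rw [inChart_F]
  have h : (fun y : ℂ ↦ constOfIsEmpty ℝ ℂ (Fin 0) (e n y)) =
      fun y ↦ e n y • constOfIsEmpty ℝ ℂ (Fin 0) (1 : ℂ) := by
    funext y; ext v; simp
  rw [h]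
  exact ((contDiff_e n).smul contDiff_const).contDiffWithinAt

/-- `F n` has type `(0,0)` (as every `0`-form). [folklore] -/
theorem isOfType_F (n : ℕ) : IsOfType 0 0 (F n) :=
  ⟨rfl, fun x θ v ↦ by simp⟩

/-- **`d(F n) = 2πi n f_n · Re`** at every point (an honest derivative, computed in the chart at the
point: `mextDeriv_eq_extDerivWithin`, `extDerivWithin_constOfIsEmpty`). [folklore] -/
theorem mextDeriv_F (n : ℕ) (x : TwistedTorus) :
    mextDeriv (F n) x =
      ofSubsingleton ℝ ℂ ℂ (0 : Fin 1) ((2 * Real.pi * Complex.I * n * fT n x) • reL) := by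
  rw [mextDeriv_eq_extDerivWithin, inChart_F, modelWithCornersSelf_coe, Set.range_id,
    extDerivWithin_constOfIsEmpty _ uniqueDiffWithinAt_univ, fderivWithin_univ,
    (hasFDerivAt_e n _).fderiv, extChartAt_coe, coe_tChart, Function.comp_apply, e_twist,
    e_sChart_self]

/-! ### The `(1,0)`- and `(0,1)`-parts of `d(F n)` -/

/-- The `ℂ`-valued `1`-form `c(x) dv` on the tangent spaces (`dv = id`, type `(1,0)`). [folklore] -/
def dv (c : TwistedTorus → ℂ) : MForm 𝓘(ℝ, ℂ) TwistedTorus ℂ 1 := fun x ↦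
  ofSubsingleton ℝ (TangentSpace 𝓘(ℝ, ℂ) x) ℂ (0 : Fin 1) (c x • ContinuousLinearMap.id ℝ ℂ)

/-- The `ℂ`-valued `1`-form `c(x) dv̄` on the tangent spaces (`dv̄ = conj`, type `(0,1)`).
[folklore] -/
def dvbar (c : TwistedTorus → ℂ) : MForm 𝓘(ℝ, ℂ) TwistedTorus ℂ 1 := fun x ↦
  ofSubsingleton ℝ (TangentSpace 𝓘(ℝ, ℂ) x) ℂ (0 : Fin 1) (c x • (Complex.conjCLE : ℂ →L[ℝ] ℂ))

/-- `(c dv)(x)(v) = c(x) v₀`. [folklore] -/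
@[simp]
theorem dv_apply (c : TwistedTorus → ℂ) (x : TwistedTorus) (v : Fin 1 → TangentSpace 𝓘(ℝ, ℂ) x) :
    dv c x v = c x * (show ℂ from v 0) := rfl

/-- `(c dv̄)(x)(v) = c(x) conj v₀`. [folklore] -/
@[simp]
theorem dvbar_apply (c : TwistedTorus → ℂ) (x : TwistedTorus) (v : Fin 1 → TangentSpace 𝓘(ℝ, ℂ) x) :
    dvbar c x v = c x * conj (show ℂ from v 0) := rfl

/-- `c dv` has type `(1,0)`. [folklore] -/
theorem isOfType_dv (c : TwistedTorus → ℂ) : IsOfType 1 0 (dv c) := by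
  refine ⟨rfl, fun x θ v ↦ ?_⟩
  rw [dv_apply, dv_apply, tangentRotate_apply]
  simp only [Nat.cast_one, Nat.cast_zero, sub_zero, Int.cast_one, one_mul, smul_eq_mul]
  ring

/-- `c dv̄` has type `(0,1)`. [folklore] -/
theorem isOfType_dvbar (c : TwistedTorus → ℂ) : IsOfType 0 1 (dvbar c) := by
  refine ⟨rfl, fun x θ v ↦ ?_⟩
  rw [dvbar_apply, dvbar_apply, tangentRotate_apply]
  simp only [Nat.cast_zero, Nat.cast_one, zero_sub, Int.cast_neg, Int.cast_one, smul_eq_mul, map_mul,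
    ← Complex.exp_conj, Complex.conj_ofReal, Complex.conj_I, mul_neg, neg_mul, one_mul]
  ring

/-- The coefficient `a_n = πi n f_n` of `∂F_n = a_n dv` and `∂̄F_n = a_n dv̄`. [folklore] -/
def a (n : ℕ) (x : TwistedTorus) : ℂ := Real.pi * Complex.I * n * fT n x

/-- **`d(F n) = a_n dv + a_n dv̄`** (`Re v = (v + v̄)/2`). [folklore] -/
theorem mextDeriv_F_eq (n : ℕ) : mextDeriv (F n) = dv (a n) + dvbar (a n) := by
  funext x
  rw [mextDeriv_F]
  ext v
  change (2 * Real.pi * Complex.I * n * fT n x) * ((show ℂ from v 0).re : ℂ) =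
    a n x * (show ℂ from v 0) + a n x * conj (show ℂ from v 0)
  rw [← mul_add, Complex.add_conj, a]
  push_cast
  ring

/-- **`∂̄(F n) = a_n dv̄`**: the `(0,1)`-component of `dF_n`. [folklore] -/
theorem dolbeaultBar_F (n : ℕ) : dolbeaultBar (F n) = dvbar (a n) := by
  rw [dolbeaultBar, Finset.Nat.antidiagonal_zero, Finset.sum_singleton]
  change (mextDeriv ((F n).typeComponent 0 0)).typeComponent 0 (0 + 1) = dvbar (a n)
  rw [(isOfType_F n).typeComponent_eq_self, mextDeriv_F_eq, MForm.typeComponent_add,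
    IsOfType.typeComponent_of_ne_holds (isOfType_dv (a n)) (Or.inl one_ne_zero),
    (isOfType_dvbar (a n)).typeComponent_eq_self]
  exact zero_add _

/-! ### The Hodge star of `c dv̄` -/

section WithMetric

attribute [local instance] bundle

/-- `det_{(1,i)}(u, w) = Re u Im w - Im u Re w`. [folklore] -/
theorem basisOneI_det_pair (u w : ℂ) :
    Complex.basisOneI.det ![u, w] = u.re * w.im - u.im * w.re := by
  rw [Basis.det_apply, Matrix.det_fin_two]
  simp [Basis.toMatrix_apply, Complex.coe_basisOneI_repr]
  ring

/-- The real part of `c dv̄` at `x` is the metric dual `⟪c, ·⟫` of the vector `c`. [folklore] -/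
theorem re_dvbar (c : TwistedTorus → ℂ) (x : TwistedTorus) :
    (dvbar c).re x = ofSubsingleton ℝ (TangentSpace 𝓘(ℝ, ℂ) x) ℝ (0 : Fin 1)
      (innerSL ℝ (show TangentSpace 𝓘(ℝ, ℂ) x from c x)) := by
  ext v
  rw [MForm.re_apply, dvbar_apply, ofSubsingleton_apply_apply, innerSL_apply_apply, inner_eq]
  simp [Complex.mul_re]

/-- The imaginary part of `c dv̄` at `x` is the metric dual of the vector `-i c`. [folklore] -/
theorem im_dvbar (c : TwistedTorus → ℂ) (x : TwistedTorus) :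
    (dvbar c).im x = ofSubsingleton ℝ (TangentSpace 𝓘(ℝ, ℂ) x) ℝ (0 : Fin 1)
      (innerSL ℝ (show TangentSpace 𝓘(ℝ, ℂ) x from -Complex.I * c x)) := by
  ext v
  rw [MForm.im_apply, dvbar_apply, ofSubsingleton_apply_apply, innerSL_apply_apply, inner_eq]
  simp [Complex.mul_im, Complex.mul_re]
  ring

/-- **The pointwise Hodge star of a metric dual** on the twisted torus:
`⋆⟪u, ·⟫ (w) = ε(x) (Re u Im w - Im u Re w)` (the discharged two-dimensional check
`hodgeStar_apply_eq_areaForm_holds`, `areaForm = vol`, and `vol_x = ε(x) det_{(1,i)}`). [folklore] -/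
theorem hodgeStar_innerSL_apply (h : 1 + 1 = 2) (x : TwistedTorus) (u w : TangentSpace 𝓘(ℝ, ℂ) x) :
    hodgeStar (orient x) h (ofSubsingleton ℝ (TangentSpace 𝓘(ℝ, ℂ) x) ℝ (0 : Fin 1) (innerSL ℝ u))
        ![w] = sgn x * ((u : ℂ).re * (w : ℂ).im - (u : ℂ).im * (w : ℂ).re) := by
  rw [hodgeStar_apply_eq_areaForm_holds (orient x) h u w, Orientation.areaForm_to_volumeForm,
    volumeForm_orient, basisT_det_apply]
  change sgn x * Complex.basisOneI.det ![(show ℂ from u), (show ℂ from w)] = _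
  rw [basisOneI_det_pair]

/-- **`⋆(c dv̄) = (ε i c) dv̄`** for the `ℂ`-linear Hodge star of the flat metric and the orientation
family `orient` (on `ℂ` with the standard orientation, `⋆dz̄ = i dz̄`). [folklore] -/
theorem cHodgeStar_dvbar (h : 1 + 1 = 2) (c : TwistedTorus → ℂ) :
    MForm.cHodgeStar orient h (dvbar c) = dvbar (fun x ↦ sgn x * Complex.I * c x) := by
  funext x
  ext v
  have hv : v = ![v 0] := by
    funext i
    fin_cases i
    rfl
  rw [MForm.cHodgeStar_apply, Pi.add_apply, Pi.smul_apply, ContinuousAlternatingMap.add_apply,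
    ContinuousAlternatingMap.smul_apply, MForm.ofReal_apply, MForm.ofReal_apply,
    MForm.hodgeStar_apply, MForm.hodgeStar_apply, re_dvbar, im_dvbar, hv,
    hodgeStar_innerSL_apply, hodgeStar_innerSL_apply, dvbar_apply]
  simp only [Matrix.cons_val_zero, smul_eq_mul]
  apply Complex.ext <;> simp [Complex.mul_re, Complex.mul_im] <;> ring

end WithMetric

/-! ### The junk: `d` of the wild form `⋆∂̄F_n` vanishes identically -/

/-- The coefficient of `γ_n = ⋆∂̄F_n = b_n dv̄`: `b_n(x) = ε(x) i a_n(x) = -ε(x) π n f_n(x)`.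
[folklore] -/
def b (n : ℕ) (x : TwistedTorus) : ℂ := sgn x * Complex.I * a n x

/-- On `D` (straight charts) `b_n = -π n f_n`. [folklore] -/
theorem b_of_mem (n : ℕ) {x : TwistedTorus} (hx : x ∈ D) : b n x = -(Real.pi * n * fT n x) := by
  rw [b, a, sgn, if_pos hx]
  push_cast
  ring_nf
  rw [Complex.I_sq]
  ring

/-- Off `D` (conjugated charts) `b_n = +π n f_n`. [folklore] -/
theorem b_of_not_mem (n : ℕ) {x : TwistedTorus} (hx : x ∉ D) : b n x = Real.pi * n * fT n x := by
  rw [b, a, sgn, if_neg hx]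
  push_cast
  ring_nf
  rw [Complex.I_sq]
  ring

/-- The twists fix `1`. [folklore] -/
@[simp]
theorem twist_one (x : TwistedTorus) : twist x 1 = 1 := by
  rcases twist_eq_or x with h | h <;> simp [h]

/-- A composite of twists fixes `1`. [folklore] -/
@[simp]
theorem twist_trans_twist_apply_one (x x' : TwistedTorus) :
    ((twist x).trans (twist x') : ℂ →L[ℝ] ℂ) 1 = 1 := by
  change twist x' (twist x 1) = 1
  rw [twist_one, twist_one]

open scoped Classical in
/-- **The chart representative of `b_n dv̄`, evaluated on the vector `1`**, at a point `y` of the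
target of the chart at `x₀`: it is `-π n e_n(y)` if `Re y ∈ ℚ` and `+π n e_n(y)` otherwise — the
value jumps on a dense set (`MForm.inChart_eq_of_mem_target`, `tangentCoordChange_eq`). [folklore] -/
theorem inChart_dvbar_b_apply_one (n : ℕ) {x₀ : TwistedTorus} {y : ℂ}
    (hy : y ∈ (extChartAt 𝓘(ℝ, ℂ) x₀).target) :
    (dvbar (b n)).inChart x₀ y ![(1 : ℂ)] =
      if y.re ∈ Set.range ((↑) : ℚ → ℝ) then -(Real.pi * n * e n y) else Real.pi * n * e n y := by
  have hz : (extChartAt 𝓘(ℝ, ℂ) x₀).symm y ∈ (chartAt ℂ x₀).source := by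
    rw [← extChartAt_source 𝓘(ℝ, ℂ)]
    exact (extChartAt 𝓘(ℝ, ℂ) x₀).map_target hy
  rw [MForm.inChart_eq_of_mem_target _ hy, ContinuousAlternatingMap.compContinuousLinearMap_apply,
    tangentCoordChange_eq hz]
  change b n ((extChartAt 𝓘(ℝ, ℂ) x₀).symm y) *
      conj (twist ((extChartAt 𝓘(ℝ, ℂ) x₀).symm y) (twist x₀ 1)) = _
  rw [twist_one, twist_one, map_one, mul_one, extChartAt_coe_symm, Function.comp_apply]
  by_cases hq : y.re ∈ Set.range ((↑) : ℚ → ℝ)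
  · have hD : proj (twist x₀ y) ∈ D := proj_mem_D_iff.mpr (by rwa [re_twist])
    rw [if_pos hq, b_of_mem n hD, fT_proj, e_twist]
  · have hD : proj (twist x₀ y) ∉ D := fun h ↦ hq (by rwa [proj_mem_D_iff, re_twist] at h)
    rw [if_neg hq, b_of_not_mem n hD, fT_proj, e_twist]

/-- **The chart representative of `b_n dv̄` is continuous at no centre of a chart** (`n ≠ 0`): along
`{Re y ∈ ℚ}` it tends to `-π n e_n(y₀)`, along the (dense) complement to `+π n e_n(y₀) ≠ -π n e_n(y₀)`.
[folklore] -/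
theorem not_continuousAt_inChart_dvbar_b {n : ℕ} (hn : n ≠ 0) (x₀ : TwistedTorus) :
    ¬ ContinuousAt ((dvbar (b n)).inChart x₀) (extChartAt 𝓘(ℝ, ℂ) x₀ x₀) := by
  set y₀ := extChartAt 𝓘(ℝ, ℂ) x₀ x₀ with hy₀def
  intro hc
  have hev : ContinuousAt (fun y ↦ (dvbar (b n)).inChart x₀ y ![(1 : ℂ)]) y₀ :=
    ((ContinuousAlternatingMap.apply ℝ ℂ ℂ ![(1 : ℂ)]).continuous.continuousAt).comp hc
  have htarget : ∀ᶠ y in 𝓝 y₀, y ∈ (extChartAt 𝓘(ℝ, ℂ) x₀).target := extChartAt_target_mem_nhds x₀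
  set Q : Set ℂ := {y : ℂ | y.re ∈ Set.range ((↑) : ℚ → ℝ)} with hQ
  have hcont : ContinuousAt (fun y : ℂ ↦ (Real.pi * n * e n y : ℂ)) y₀ :=
    (continuous_const.mul (contDiff_e n).continuous).continuousAt
  -- along the rational real parts
  have h1 : (dvbar (b n)).inChart x₀ y₀ ![(1 : ℂ)] = -(Real.pi * n * e n y₀) := by
    haveI : (𝓝[Q] y₀).NeBot := mem_closure_iff_nhdsWithin_neBot.mp
      (by rw [dense_re_mem_range_ratCast.closure_eq]; exact Set.mem_univ _)
    have hlim1 : Tendsto (fun y ↦ (dvbar (b n)).inChart x₀ y ![(1 : ℂ)]) (𝓝[Q] y₀)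
        (𝓝 ((dvbar (b n)).inChart x₀ y₀ ![(1 : ℂ)])) := hev.tendsto.mono_left nhdsWithin_le_nhds
    have hlim2 : Tendsto (fun y ↦ (dvbar (b n)).inChart x₀ y ![(1 : ℂ)]) (𝓝[Q] y₀)
        (𝓝 (-(Real.pi * n * e n y₀))) := by
      refine (hcont.neg.tendsto.mono_left nhdsWithin_le_nhds).congr' ?_
      filter_upwards [mem_nhdsWithin_of_mem_nhds htarget, self_mem_nhdsWithin] with y hy hyQ
      rw [inChart_dvbar_b_apply_one n hy, if_pos (show y.re ∈ Set.range ((↑) : ℚ → ℝ) from hyQ)]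
      rfl
    exact tendsto_nhds_unique hlim1 hlim2
  -- along the irrational real parts
  have h2 : (dvbar (b n)).inChart x₀ y₀ ![(1 : ℂ)] = Real.pi * n * e n y₀ := by
    haveI : (𝓝[Qᶜ] y₀).NeBot := mem_closure_iff_nhdsWithin_neBot.mp (by
      change y₀ ∈ closure {z : ℂ | z.re ∉ Set.range ((↑) : ℚ → ℝ)}
      rw [dense_re_not_mem_range_ratCast.closure_eq]; exact Set.mem_univ _)
    have hlim1 : Tendsto (fun y ↦ (dvbar (b n)).inChart x₀ y ![(1 : ℂ)]) (𝓝[Qᶜ] y₀)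
        (𝓝 ((dvbar (b n)).inChart x₀ y₀ ![(1 : ℂ)])) := hev.tendsto.mono_left nhdsWithin_le_nhds
    have hlim2 : Tendsto (fun y ↦ (dvbar (b n)).inChart x₀ y ![(1 : ℂ)]) (𝓝[Qᶜ] y₀)
        (𝓝 (Real.pi * n * e n y₀)) := by
      refine (hcont.tendsto.mono_left nhdsWithin_le_nhds).congr' ?_
      filter_upwards [mem_nhdsWithin_of_mem_nhds htarget, self_mem_nhdsWithin] with y hy hyQ
      rw [inChart_dvbar_b_apply_one n hy, if_neg (show y.re ∉ Set.range ((↑) : ℚ → ℝ) from hyQ)]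
    exact tendsto_nhds_unique hlim1 hlim2
  have hne : (Real.pi * n * e n y₀ : ℂ) ≠ 0 :=
    mul_ne_zero (mul_ne_zero (by exact_mod_cast Real.pi_ne_zero) (by exact_mod_cast hn)) (e_ne_zero n y₀)
  rw [h1] at h2
  exact hne (by linear_combination -(h2) / 2)

/-- **`d(⋆∂̄F_n) = 0` identically** (`n ≠ 0`): at every point the chart representative of
`b_n dv̄` is discontinuous, so Mathlib's `fderivWithin` — and with it the tree's chart-wise
exterior derivative `mextDeriv` — returns the junk value `0`. [folklore] -/
theorem mextDeriv_dvbar_b {n : ℕ} (hn : n ≠ 0) : mextDeriv (dvbar (b n)) = 0 := by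
  funext x₀
  have hnd : ¬ DifferentiableWithinAt ℝ ((dvbar (b n)).inChart x₀) Set.univ
      (extChartAt 𝓘(ℝ, ℂ) x₀ x₀) := fun hd ↦
    not_continuousAt_inChart_dvbar_b hn x₀ (hd.differentiableAt Filter.univ_mem).continuousAt
  have hext : extDerivWithin ((dvbar (b n)).inChart x₀) (Set.range (𝓘(ℝ, ℂ) : ℂ → ℂ))
      (extChartAt 𝓘(ℝ, ℂ) x₀ x₀) = 0 := by
    rw [modelWithCornersSelf_coe, Set.range_id, extDerivWithin,
      fderivWithin_zero_of_not_differentiableWithinAt hnd]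
    ext v
    simp [alternatizeUncurryFin_apply]
  change (extDerivWithin ((dvbar (b n)).inChart x₀) (Set.range (𝓘(ℝ, ℂ) : ℂ → ℂ))
    (extChartAt 𝓘(ℝ, ℂ) x₀ x₀)).compContinuousLinearMap
      (mfderiv 𝓘(ℝ, ℂ) 𝓘(ℝ, ℂ) (extChartAt 𝓘(ℝ, ℂ) x₀) x₀) = 0
  rw [hext]
  ext v
  rfl

/-- **`∂(⋆∂̄F_n) = 0`** (`n ≠ 0`): `⋆∂̄F_n = b_n dv̄` has type `(0,1)`, its `(0,1)`-part has
vanishing `d` by the previous lemma and its other parts vanish. [folklore] -/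
theorem dolbeault_dvbar_b {n : ℕ} (hn : n ≠ 0) : dolbeault (dvbar (b n)) = 0 := by
  rw [dolbeault]
  refine Finset.sum_eq_zero fun pq hpq ↦ ?_
  rw [Finset.mem_antidiagonal] at hpq
  by_cases h01 : pq = (0, 1)
  · rw [h01]
    change (mextDeriv ((dvbar (b n)).typeComponent 0 1)).typeComponent (0 + 1) 1 = 0
    rw [(isOfType_dvbar (b n)).typeComponent_eq_self, mextDeriv_dvbar_b hn, MForm.typeComponent_zero]
  · have hne : 0 ≠ pq.1 ∨ 1 ≠ pq.2 := by
      by_contra hcon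
      simp only [not_or, not_not] at hcon
      exact h01 (Prod.ext hcon.1.symm hcon.2.symm)
    rw [IsOfType.typeComponent_of_ne_holds (isOfType_dvbar (b n)) hne, mextDeriv_zero,
      MForm.typeComponent_zero]

/-! ### `F n` is `∂̄`-harmonic -/

section WithMetric

attribute [local instance] bundle

/-- **`Δ_∂̄ F_n = ∂̄*∂̄ F_n = -⋆∂⋆(∂̄F_n) = 0`** for every `n ≠ 0`, for the flat metric and the
orientation family of the twisted torus. [folklore] -/
theorem dolbeaultLaplacian_F {n : ℕ} (hn : n ≠ 0) (h : 0 + 2 = 2) :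
    dolbeaultLaplacian orient 0 2 h (F n) = 0 := by
  change dolbeaultBarAdjoint orient (m := 1) (show (0 + 1) + 1 = 2 by rfl) (dolbeaultBar (F n)) = 0
  rw [dolbeaultBarAdjoint, dolbeaultBar_F, cHodgeStar_dvbar]
  change -MForm.cHodgeStar orient _ (dolbeault (dvbar (b n))) = 0
  rw [dolbeault_dvbar_b hn, _root_.map_zero, neg_zero]

/-- **`F n` is `∂̄`-harmonic of type `(0,0)`** (`n ≠ 0`). [folklore] -/
theorem isDolbeaultHarmonic_F {n : ℕ} (hn : n ≠ 0) (h : 0 + 2 = 2) :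
    IsDolbeaultHarmonic orient 0 0 h (F n) :=
  ⟨isSmoothForm_F n, isOfType_F n, dolbeaultLaplacian_F hn h⟩

end WithMetric

/-! ### An infinite linearly independent family of `∂̄`-harmonic forms -/

/-- The additive characters `t ↦ e^{2πi n t}` of `ℝ`, as monoid homomorphisms
`Multiplicative ℝ →* ℂ`. [folklore] -/
def χ (n : ℕ) : Multiplicative ℝ →* ℂ where
  toFun t := Complex.exp (2 * Real.pi * Complex.I * n * (t.toAdd : ℂ))
  map_one' := by simp
  map_mul' s t := by
    rw [← Complex.exp_add, toAdd_mul, Complex.ofReal_add]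
    ring_nf

/-- `χ n t = e^{2πi n t}`. [folklore] -/
theorem χ_apply (n : ℕ) (t : Multiplicative ℝ) :
    χ n t = Complex.exp (2 * Real.pi * Complex.I * n * (t.toAdd : ℂ)) := rfl

/-- Distinct frequencies give distinct characters (evaluate at `√2`). [folklore] -/
theorem χ_injective : Function.Injective χ := by
  intro n m hnm
  have h := congrArg (fun f : Multiplicative ℝ →* ℂ ↦ f (Multiplicative.ofAdd (Real.sqrt 2))) hnm
  simp only [χ_apply, toAdd_ofAdd] at h
  obtain ⟨k, hk⟩ := Complex.exp_eq_exp_iff_exists_int.mp h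
  have hk' : ((n : ℝ) - m) * Real.sqrt 2 = k := by
    have h2 : (2 * Real.pi * Complex.I : ℂ) ≠ 0 := by simp [Real.pi_ne_zero, Complex.I_ne_zero]
    have h3 : (2 * Real.pi * Complex.I) * (((n : ℝ) - m) * Real.sqrt 2 : ℝ) =
        (2 * Real.pi * Complex.I) * (k : ℂ) := by
      push_cast
      linear_combination hk
    exact_mod_cast mul_left_cancel₀ h2 h3
  by_contra hne
  have hd : ((n : ℤ) - m : ℤ) ≠ 0 := by omega
  have hirr : Irrational ((((n : ℤ) - m : ℤ) : ℝ) * Real.sqrt 2) := irrational_sqrt_two.intCast_mul hd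
  refine hirr.ne_int k ?_
  rw [← hk']
  push_cast
  ring

/-- **The characters `t ↦ e^{2πi n t}` (`n ≥ 1`) are linearly independent over `ℂ`** (Dedekind's
independence of characters, `linearIndependent_monoidHom`). [folklore] -/
theorem linearIndependent_χ_succ :
    LinearIndependent ℂ (fun n : ℕ ↦ (χ (n + 1) : Multiplicative ℝ → ℂ)) :=
  (linearIndependent_monoidHom (Multiplicative ℝ) ℂ).comp (fun n : ℕ ↦ χ (n + 1))
    fun _ _ h ↦ Nat.succ_injective (χ_injective h)

/-- Evaluation of a complex `0`-form on the torus along the real line `t ↦ proj t`, a `ℂ`-linear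
map to functions on `ℝ`. [folklore] -/
def evalLine : MForm 𝓘(ℝ, ℂ) TwistedTorus ℂ 0 →ₗ[ℂ] (Multiplicative ℝ → ℂ) where
  toFun α t := α (proj ((t.toAdd : ℝ) : ℂ)) ![]
  map_add' _ _ := rfl
  map_smul' _ _ := rfl

/-- Along the real line `F n` is the character `χ n`. [folklore] -/
theorem evalLine_F (n : ℕ) : evalLine (F n) = (χ n : Multiplicative ℝ → ℂ) := by
  funext t
  change F n (proj ((t.toAdd : ℝ) : ℂ)) ![] = χ n t
  rw [F_apply, fT_proj, χ_apply, e, Complex.ofReal_re]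

/-- **The forms `F (n+1)`, `n : ℕ`, are linearly independent over `ℂ`.** [folklore] -/
theorem linearIndependent_F_succ : LinearIndependent ℂ (fun n : ℕ ↦ F (n + 1)) := by
  refine LinearIndependent.of_comp evalLine ?_
  have h : ⇑evalLine ∘ (fun n : ℕ ↦ F (n + 1)) = fun n : ℕ ↦ (χ (n + 1) : Multiplicative ℝ → ℂ) := by
    funext n
    exact evalLine_F (n + 1)
  rw [h]
  exact linearIndependent_χ_succ

section WithMetric

attribute [local instance] bundle

/-- **`ℋ^{0,0}` of the twisted torus is not finite-dimensional**: it contains the infinite linearly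
independent family `F (n+1)`. [folklore] -/
theorem not_module_finite_dolbeaultHarmonicForms (h : 0 + 2 = 2) :
    ¬ Module.Finite ℂ ↥(dolbeaultHarmonicForms orient 0 0 h) := by
  intro hfin
  set v : ℕ → ↥(dolbeaultHarmonicForms orient 0 0 h) := fun n ↦
    ⟨F (n + 1), (isDolbeaultHarmonic_F (Nat.succ_ne_zero n) h).mem_dolbeaultHarmonicForms⟩ with hv
  have hli : LinearIndependent ℂ v := by
    refine LinearIndependent.of_comp (dolbeaultHarmonicForms orient 0 0 h).subtype ?_
    exact linearIndependent_F_succ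
  exact Module.Finite.not_linearIndependent_of_infinite v hli

/-- **The named fact `Literature.NumberTheory.Transcendental.finite_dolbeaultHarmonicForms` is false
as stated, already in degree `0`.** For the twisted torus `ℂ/ℤ[i]` (`E = ℂ`, `n = 2`, degree
`k = 0`, `m = 2`, type `(0,0)`), its flat Hermitian metric `flatMetric` and the orientation family
`orient` with smooth volume form, the space `ℋ^{0,0}` of `∂̄`-harmonic *functions* is
infinite-dimensional (on an honest complex torus it is `ℂ`). A second, independent witness to the
sibling refutation in bidegree `(1,1)` on the `{id, conj}`-rigged torus `(ℝ/ℤ)²`,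
`TorusConjAtlas.not_finite_dolbeaultHarmonicForms_torus` (`KaehlerHodgeFiniteCounterexample.lean`,
which also records the universal closures `not_forall_finite_dolbeaultHarmonicForms`,
`not_finite_dolbeaultHarmonicForms`). The intended statement (complex manifold; Voisin (2002),
Cor. 5.20 + Thm. 5.22 / Cor. 5.25) is `finite_dolbeaultHarmonicForms_of_isManifold`
(`KaehlerHodgeComplexAtlasFact.lean`), which binds the holomorphic atlas. [folklore] -/
theorem not_finite_dolbeaultHarmonicForms_twistedTorus :
    ¬ finite_dolbeaultHarmonicForms (k := 0) (m := 2) flatMetric orient := fun H ↦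
  not_module_finite_dolbeaultHarmonicForms rfl
    (H isHermitian_flatMetric (p := 0) (q := 0) rfl isSmoothForm_riemannianVolumeForm)

end WithMetric

end TwistedTorus

end Literature.NumberTheory.Transcendental
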